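import Literature.Geometry.ComplexAnalytic.CyclicNodePencilShellSubmersion
import Mathlib.Analysis.SpecialFunctions.SmoothTransition
import Mathlib.Analysis.InnerProductSpace.Calculus
import HarnessLib

/-!
# A global `C^∞` cut-off of the Morse radius `Σ|Θ(y)|²` of the nodal pencil

Family `hodge`, layer `Literature/Geometry/ComplexAnalytic`; sequel of `CyclicNodePencilMorseChart` / `CyclicNodePencilShellSubmersion`. The Morse
radius `r(y) = Σᵢ |(Θ y)ᵢ|²` of the pencil `x₃^p = x₀x₁ + x₀^p + x₁^p + c` is defined and smooth only on the source of the Morse chart `Θ`. For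
the global constructions on the ambient manifold (`Motives/UniversalHypersurfaceRegularLocusChartFunction.regChartExtend`, the tangent lift
`Motives/UniversalHypersurfaceRegularLocusLift`) one needs a `C^∞` function on all of `ℂ³`, with bounded support, equal to `r` where
`r ≤ R''`: multiply by the smooth step `smoothTransition ((R' − r)/(R' − R''))` (`= 1` for `r ≤ R''`, `= 0` for `r ≥ R'`) and extend by `0`
off `Θ.source`; this is smooth as soon as the closed radius-`R'` region `{z | Σ|zᵢ|² ≤ R'}` lies in `Θ.target` (its preimage under the
homeomorphism `Θ` is then a compact subset of the source carrying the support).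

* `morseRadiusCutoff Θ R'' R'` — the function; `morseRadiusCutoff_of_le` (`= r(y)` when `r(y) ≤ R''`), `morseRadiusCutoff_eq_zero_of_not_mem`
  (`= 0` off `Θ⁻¹{Σ|z|² < R'}`);
* `isCompact_symm_image_radius_le`, `tsupport_morseRadiusCutoff_subset` — the support lies in the compact `Θ.symm '' {Σ|zᵢ|² ≤ R'}`;
* `contDiff_morseRadiusCutoff` — it is `C^∞` on `ℂ³`; `morseRadiusCutoff_eventuallyEq` — near a point with `r < R''` it IS `r`;
* `exists_bound_morseRadiusCutoff` — it vanishes outside a norm ball (`‖y‖ > R ⇒ 0`).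

Everything is proved; the one definition is concrete; no named facts.

## References

* [BrockerJanichIDT1982] T. Bröcker, K. Jänich, Introduction to Differential Topology (1982), §7 (bump functions).
* [Milnor1968] J. Milnor, Singular Points of Complex Hypersurfaces (1968), §5 (the Milnor ball).
-/

noncomputable section

open Set Filter Topology Function
open scoped ContDiff

namespace Literature.Geometry.ComplexAnalytic

namespace PhamBrieskorn

variable (Θ : OpenPartialHomeomorph (Fin (1 + 2) → ℂ) (Fin (1 + 2) → ℂ)) (R'' R' : ℝ)

open scoped Classical in
/-- **The cut-off Morse radius**: `y ↦ smoothTransition((R' − r(y))/(R' − R'')) · r(y)` on `Θ.source`, `r(y) = Σᵢ |(Θ y)ᵢ|²`, and `0` off it.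
[cite: BrockerJanichIDT1982, §7] -/
def morseRadiusCutoff (y : Fin (1 + 2) → ℂ) : ℝ :=
  if y ∈ Θ.source then
    Real.smoothTransition ((R' - ∑ i, ‖Θ y i‖ ^ 2) / (R' - R'')) * ∑ i, ‖Θ y i‖ ^ 2
  else 0

/-- On the source the cut-off radius is the product formula. [cite: BrockerJanichIDT1982, §7] -/
theorem morseRadiusCutoff_of_mem {y : Fin (1 + 2) → ℂ} (hy : y ∈ Θ.source) :
    morseRadiusCutoff Θ R'' R' y = Real.smoothTransition ((R' - ∑ i, ‖Θ y i‖ ^ 2) / (R' - R'')) * ∑ i, ‖Θ y i‖ ^ 2 := by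
  classical
  simp [morseRadiusCutoff, hy]

/-- Off the source the cut-off radius vanishes. [cite: BrockerJanichIDT1982, §7] -/
theorem morseRadiusCutoff_of_not_mem {y : Fin (1 + 2) → ℂ} (hy : y ∉ Θ.source) : morseRadiusCutoff Θ R'' R' y = 0 := by
  classical
  simp [morseRadiusCutoff, hy]

/-- **Where `r ≤ R''` the cut-off radius is the radius** (`R'' < R'`). [cite: BrockerJanichIDT1982, §7] -/
theorem morseRadiusCutoff_of_le (hR : R'' < R') {y : Fin (1 + 2) → ℂ} (hy : y ∈ Θ.source) (hle : ∑ i, ‖Θ y i‖ ^ 2 ≤ R'') :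
    morseRadiusCutoff Θ R'' R' y = ∑ i, ‖Θ y i‖ ^ 2 := by
  rw [morseRadiusCutoff_of_mem Θ R'' R' hy, Real.smoothTransition.one_of_one_le, one_mul]
  rw [le_div_iff₀ (sub_pos.mpr hR), one_mul]
  linarith

/-- Where `r ≥ R'` (inside the source) the cut-off radius vanishes (`R'' < R'`). [cite: BrockerJanichIDT1982, §7] -/
theorem morseRadiusCutoff_of_ge (hR : R'' < R') {y : Fin (1 + 2) → ℂ} (hy : y ∈ Θ.source) (hge : R' ≤ ∑ i, ‖Θ y i‖ ^ 2) :
    morseRadiusCutoff Θ R'' R' y = 0 := by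
  rw [morseRadiusCutoff_of_mem Θ R'' R' hy, Real.smoothTransition.zero_of_nonpos, zero_mul]
  exact div_nonpos_of_nonpos_of_nonneg (by linarith) (sub_pos.mpr hR).le

/-- The support of the cut-off radius lies in `Θ⁻¹{Σ|zᵢ|² < R'} ∩ Θ.source` (`R'' < R'`). [cite: BrockerJanichIDT1982, §7] -/
theorem support_morseRadiusCutoff_subset (hR : R'' < R') :
    Function.support (morseRadiusCutoff Θ R'' R') ⊆ Θ.symm '' (Θ.target ∩ {z | ∑ i, ‖z i‖ ^ 2 ≤ R'}) := by
  intro y hy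
  rw [Function.mem_support] at hy
  have hys : y ∈ Θ.source := by
    by_contra h
    exact hy (morseRadiusCutoff_of_not_mem Θ R'' R' h)
  have hlt : ∑ i, ‖Θ y i‖ ^ 2 < R' := by
    by_contra h
    exact hy (morseRadiusCutoff_of_ge Θ R'' R' hR hys (not_lt.mp h))
  exact ⟨Θ y, ⟨Θ.map_source hys, hlt.le⟩, Θ.left_inv hys⟩

/-- The radius region `{z | Σ|zᵢ|² ≤ R'}` is compact (closed and bounded in `ℂ³`). [cite: Milnor1968, §5] -/
theorem isCompact_radius_le (R : ℝ) : IsCompact {z : Fin (1 + 2) → ℂ | ∑ i, ‖z i‖ ^ 2 ≤ R} := by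
  have hcont : Continuous fun z : Fin (1 + 2) → ℂ => ∑ i, ‖z i‖ ^ 2 := by fun_prop
  have hclosed : IsClosed {z : Fin (1 + 2) → ℂ | ∑ i, ‖z i‖ ^ 2 ≤ R} := isClosed_le hcont continuous_const
  refine Metric.isCompact_of_isClosed_isBounded hclosed ?_
  refine (Metric.isBounded_closedBall (x := (0 : Fin (1 + 2) → ℂ)) (r := Real.sqrt (max R 0))).subset fun z hz => ?_
  rw [Metric.mem_closedBall, dist_zero_right, pi_norm_le_iff_of_nonneg (Real.sqrt_nonneg _)]
  intro i
  have hi : ‖z i‖ ^ 2 ≤ ∑ j, ‖z j‖ ^ 2 := Finset.single_le_sum (fun j _ => sq_nonneg ‖z j‖) (Finset.mem_univ i)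
  have h2 : ‖z i‖ ^ 2 ≤ max R 0 := (hi.trans hz).trans (le_max_left _ _)
  exact Real.le_sqrt_of_sq_le h2

/-- If `{Σ|zᵢ|² ≤ R'} ⊆ Θ.target`, its preimage `Θ.symm '' (…)` is a compact subset of `Θ.source`. [cite: Milnor1968, §5] -/
theorem isCompact_symm_image_radius_le (hR' : {z : Fin (1 + 2) → ℂ | ∑ i, ‖z i‖ ^ 2 ≤ R'} ⊆ Θ.target) :
    IsCompact (Θ.symm '' (Θ.target ∩ {z | ∑ i, ‖z i‖ ^ 2 ≤ R'})) ∧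
      Θ.symm '' (Θ.target ∩ {z | ∑ i, ‖z i‖ ^ 2 ≤ R'}) ⊆ Θ.source := by
  have heq : Θ.target ∩ {z : Fin (1 + 2) → ℂ | ∑ i, ‖z i‖ ^ 2 ≤ R'} = {z | ∑ i, ‖z i‖ ^ 2 ≤ R'} :=
    Set.inter_eq_right.mpr hR'
  refine ⟨?_, ?_⟩
  · rw [heq]
    exact (isCompact_radius_le R').image_of_continuousOn (Θ.continuousOn_symm.mono hR')
  · rintro _ ⟨z, hz, rfl⟩
    exact Θ.map_target hz.1

/-- **The topological support of the cut-off radius is compact and lies in `Θ.source`** (`R'' < R'`, `{Σ|zᵢ|² ≤ R'} ⊆ Θ.target`).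
[cite: BrockerJanichIDT1982, §7] -/
theorem tsupport_morseRadiusCutoff_subset (hR : R'' < R') (hR' : {z : Fin (1 + 2) → ℂ | ∑ i, ‖z i‖ ^ 2 ≤ R'} ⊆ Θ.target) :
    tsupport (morseRadiusCutoff Θ R'' R') ⊆ Θ.symm '' (Θ.target ∩ {z | ∑ i, ‖z i‖ ^ 2 ≤ R'}) ∧
      tsupport (morseRadiusCutoff Θ R'' R') ⊆ Θ.source := by
  obtain ⟨hc, hsub⟩ := isCompact_symm_image_radius_le Θ R' hR'
  have h1 : tsupport (morseRadiusCutoff Θ R'' R') ⊆ Θ.symm '' (Θ.target ∩ {z | ∑ i, ‖z i‖ ^ 2 ≤ R'}) :=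
    closure_minimal (support_morseRadiusCutoff_subset Θ R'' R' hR) hc.isClosed
  exact ⟨h1, h1.trans hsub⟩

/-- **The cut-off radius is `C^∞` on `ℂ³`** (`Θ` `C^∞` on its source, `R'' < R'`, `{Σ|zᵢ|² ≤ R'} ⊆ Θ.target`): on the source it is a
product of smooth functions, off its (closed) support it vanishes identically. [cite: BrockerJanichIDT1982, §7] -/
theorem contDiff_morseRadiusCutoff (hΘ : ContDiffOn ℝ ∞ Θ Θ.source) (hR : R'' < R')
    (hR' : {z : Fin (1 + 2) → ℂ | ∑ i, ‖z i‖ ^ 2 ≤ R'} ⊆ Θ.target) :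
    ContDiff ℝ ∞ (morseRadiusCutoff Θ R'' R') := by
  rw [contDiff_iff_contDiffAt]
  intro y
  by_cases hy : y ∈ tsupport (morseRadiusCutoff Θ R'' R')
  · have hys : y ∈ Θ.source := (tsupport_morseRadiusCutoff_subset Θ R'' R' hR hR').2 hy
    -- the radius `r` is smooth at `y`
    have hr : ContDiffAt ℝ ∞ (fun y : Fin (1 + 2) → ℂ => ∑ i, ‖Θ y i‖ ^ 2) y := by
      have hΘy : ContDiffAt ℝ ∞ (Θ : (Fin (1 + 2) → ℂ) → Fin (1 + 2) → ℂ) y := hΘ.contDiffAt (Θ.open_source.mem_nhds hys)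
      refine ContDiffAt.sum fun i _ => ?_
      have hi : ContDiffAt ℝ ∞ (fun y : Fin (1 + 2) → ℂ => Θ y i) y :=
        (contDiffAt_apply ℝ ℂ i (Θ y)).comp y hΘy
      exact hi.norm_sq ℝ
    have hprod : ContDiffAt ℝ ∞ (fun y : Fin (1 + 2) → ℂ =>
        Real.smoothTransition ((R' - ∑ i, ‖Θ y i‖ ^ 2) / (R' - R'')) * ∑ i, ‖Θ y i‖ ^ 2) y :=
      ((Real.smoothTransition.contDiff.contDiffAt).comp y ((contDiffAt_const.sub hr).div_const _)).mul hr
    refine hprod.congr_of_eventuallyEq ?_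
    filter_upwards [Θ.open_source.mem_nhds hys] with y' hy'
    exact morseRadiusCutoff_of_mem Θ R'' R' hy'
  · rw [notMem_tsupport_iff_eventuallyEq] at hy
    exact contDiffAt_const.congr_of_eventuallyEq hy

/-- **Near a point `y₀ ∈ Θ.source` with `r(y₀) < R''` the cut-off radius IS the radius** (as germs). [cite: BrockerJanichIDT1982, §7] -/
theorem morseRadiusCutoff_eventuallyEq (hR : R'' < R') {y₀ : Fin (1 + 2) → ℂ} (hy₀ : y₀ ∈ Θ.source)
    (hlt : ∑ i, ‖Θ y₀ i‖ ^ 2 < R'') :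
    morseRadiusCutoff Θ R'' R' =ᶠ[𝓝 y₀] fun y => ∑ i, ‖Θ y i‖ ^ 2 := by
  have hcont : ContinuousAt (fun y : Fin (1 + 2) → ℂ => ∑ i, ‖Θ y i‖ ^ 2) y₀ := by
    have hΘc : ContinuousAt (Θ : (Fin (1 + 2) → ℂ) → Fin (1 + 2) → ℂ) y₀ := Θ.continuousAt hy₀
    refine tendsto_finsetSum _ fun i _ => ?_
    exact ((continuous_apply i).continuousAt.comp hΘc).norm.pow 2
  have hlt' : ∀ᶠ y in 𝓝 y₀, ∑ i, ‖Θ y i‖ ^ 2 < R'' := hcont.eventually (gt_mem_nhds hlt)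
  filter_upwards [hlt', Θ.open_source.mem_nhds hy₀] with y hy hys
  exact morseRadiusCutoff_of_le Θ R'' R' hR hys hy.le

/-- **The cut-off radius vanishes outside a norm ball** (its support is compact). [cite: BrockerJanichIDT1982, §7] -/
theorem exists_bound_morseRadiusCutoff (hR : R'' < R') (hR' : {z : Fin (1 + 2) → ℂ | ∑ i, ‖z i‖ ^ 2 ≤ R'} ⊆ Θ.target) :
    ∃ R : ℝ, ∀ y : Fin (1 + 2) → ℂ, R < ‖y‖ → morseRadiusCutoff Θ R'' R' y = 0 := by
  obtain ⟨hc, -⟩ := isCompact_symm_image_radius_le Θ R' hR'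
  obtain ⟨R, hRb⟩ := hc.isBounded.subset_closedBall (0 : Fin (1 + 2) → ℂ)
  refine ⟨R, fun y hy => ?_⟩
  by_contra hne
  have hmem : y ∈ Θ.symm '' (Θ.target ∩ {z | ∑ i, ‖z i‖ ^ 2 ≤ R'}) :=
    support_morseRadiusCutoff_subset Θ R'' R' hR (Function.mem_support.mpr hne)
  have := hRb hmem
  rw [Metric.mem_closedBall, dist_zero_right] at this
  exact absurd hy (not_lt.mpr this)

end PhamBrieskorn

end Literature.Geometry.ComplexAnalytic

end
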